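import Summits.QuantumFields.BalabanUV.T4Continuum.Spine.NE1p.DressedSmallFieldNestedToriTowerLive
import Summits.QuantumFields.BalabanUV.T4Continuum.Spine.NE1p.DressedSmallFieldComponentInnerMuNestedTori

/-!
# T⁴ programme, spine estimate NE1′ (node O3b/H2) — THE μ-PART OFF THE BOUNDARY ON THE TOWER: the μ-twin of S44's END (crew S57 §1,
# `muPart_locE_le_of_coresAt_pencil_components_nestedTori`, generic inner data) FIRED ONCE on W75's three-torus datum at `r₁ = ½` and at
# the coarse ROD of tree length one — `≤ (K₀(64,8)∕2)·e^{−3}·μ₀∕(2 − μ₀)` for `‖sμ‖ ≤ μ₀ < 2`; live; and WHERE it beats W75's table bound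

Cell `pub-balaban`, sub-cell `t4`, BINDER-OWNERS row NE1′; crew `b2b-balaban-t4-ne1p-formalise-*`, row **W⟨next⟩** of `t4/formal/NE1p/LEAVES.md`
(INTENT `HOME/CLAIMS.log` — the typer's id at booking), unit `b2b-balaban-t4-ne1p-formalise-leaf-10` (gen 12).  A FOLLOWER ON A LANDED WITNESS
DATUM — imports W75 PART 3 `Spine/NE1p/DressedSmallFieldNestedToriTowerLive` (p241416; → W75 P1∕P2: the tower, `CR`, `termsT`∕`actT`∕`GT`∕`A₁T`∕
`vT`∕`RkpT`, `hrate_T`∕`hRR_T`∕`hsmall_T`∕`hadm_T`∕`hAmp_T`, `actT_real_sub_zero`, `norm_actT_CR_lt_one`, `exp_locE_actT`, `towerEnd_fires_closed`) and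
crew S57 `Spine/NE1p/DressedSmallFieldComponentInnerMuNestedTori` (p240443, leaf-01 g15; §1 = THE μ-END with generic inner data) ONLY, and re-enters
W75's namespace; THEOREMS ONLY (0 def, 0 `def … : Prop`, 0 cite, 0 sorry, 0 `attribute`) + one closing `example`; S57 §1's END applied EXACTLY
ONCE BY NAME (`towerMuEnd_fires`); nothing of S57 ∕ S44 ∕ W75 ∕ W72 ∕ W59 ∕ W67 restated.

WHY.  W75 took the TABLE side of S44's END off the `r₁`-boundary on both counts (rate `½`, coarse polymer of tree length `1`).  The μ-SIDE of
the same (B3-count) chain on the nested tori is crew S57 (leaf-01 g15): its decided appliers so far (W82 on W69's centre-cube datum; W81 at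
N0o's one-torus μ-face on W72's rod) sit at `r₁ = 0` resp. on one torus.  THIS FILE fires S57 §1 on W75's datum UNCHANGED:
* §1 **`towerMuEnd_fires`** — S57 §1 ONCE at `(L, N′) := (L, L·M)`, `X₀ := CR L M`, the SAME cores `GT`, index `termsT`, activity `actT` read
  along the SOURCE pencil `sμ ↦ 0 + sμ • liveTable` (`v := liveTable`, `μ₁ := 2` — the radius at which W75's `hAmp_T` is typed), `A := 0 + 2·A₁T`
  (so `hsmall` IS W75's `hsmall_T` and `hAmp` IS W75's `hAmp_T`, both BY NAME), `r₁ := ½`, `hrate := hrate_T`, `hRR := hRR_T`, `vW := vT`,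
  `hadm := hadm_T`, W59.1's `hκ_N_eq`∕`hκR_N`∕`hrate2_N_eq`∕`h229_N_eq`∕`hinner_N_eq`; conclusion LITERAL with the factor
  `exp (−(½ · torusTreeLen (CR L M).1))` and the source window factor `μ₀∕(2 − μ₀)`; **`towerMuEnd_fires_closed : … ≤ K₀(64,8)∕2 · e^{−3} ·
  μ₀∕(2 − μ₀)`** (`torusTreeLen_CR = 1`);
* §2 **`towerMuEnd_live`**: for a REAL source `0 < t ≤ 2`, `E_{act t}(C_R) ≠ E_{act 0}(C_R)` (W75 P3's `exp_locE_actT` + P2's `actT_real_sub_zero`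
  + W33's `integral_incr_pos` at the rate `t·r > 0`) — the μ-END's bounded quantity is NOT zero anywhere in the punctured real window;
* §3 LOCATED COMPARISON (our two bounds for the SAME difference `E_{act sμ} − E_{act 0}` on this datum, at `sμ` real in `(0, 2)`): the μ-END's
  `(K₀∕2)e^{−3}·μ₀∕(2−μ₀)` vs W75 P2's table bound `K₀e^{−3}` (valid at `sμ = 1`; at a general real `t ≤ 2` W75's END is not re-fired here):
  **`muBound_le_tableBound_iff : (K₀∕2)e^{−3}·μ₀∕(2−μ₀) ≤ K₀e^{−3} ↔ μ₀ ≤ 4∕3`** (`0 < μ₀ < 2`) — the threshold `4∕3` that leaf-09's W81 (N0o's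
  faces on W72's rod) and leaf-01's W82 (S57 §2 on W69's datum) located on THEIR data appears on the tower too: it is the window algebra
  `μ₀∕(2−μ₀) ≤ 2`, datum-independent; closing `example` at L = 5: bound ∧ liveness at `μ₀ = 1`.

HONEST FRAMING.  A DECIDED TOY — W75's datum UNCHANGED, S57 §1 composed BY NAME ([folklore]∕[arith]); every numeral OURS in S44's literal
currency; `hinner` CHOSEN (W59's `mN`); (B1b) NOT claimed; (B3-amp) MET by CHOSEN weights — UNPRINTED for Bałaban's cores (G-ne9p2-5); the
rate leaves the boundary only because W75 RE-CHOSE the letters — bookkeeping on a toy, NOT slack on Bałaban's densities; the `4∕3` is a fact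
about OUR two bound SHAPES, not about print; no numeral of [Balaban1988RGII]∕[Balaban1987RGI] asserted ((2.35)–(2.41), «L odd > 11» TYPE only);
WHICH tori are Bałaban's = pv22's READING (D-pv22.3); 0 binders instantiated on Bałaban's densities; no wall item; wall v1.8 (T4-DAG v48∕v49) —
words, not kind — does NOT move; R-t4r2-Q2 NOT met; NE1′ ⇐ the named binders — NOT proved, NOT printed; spine PROVED 0∕9; count 9 unchanged;
ABSOLUTE RULE honoured.  Rung (B)+1 on ONE finite four-torus — NOT infinite volume, NOT a mass gap, NOT OS on ℝ⁴, NOT Clay.  HONEST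
DEPENDENCY: continuum YM on T⁴ ⇐ BetaPertH ∧ nine spine estimates (0/9 proved); BetaPertH ⇐ (D1) ∧ (D4) ∧ CAP+tail; G-an2-4 gates asym,
D1 and NE2/3/4.
-/

noncomputable section

namespace Summit.QuantumFields.BalabanUV.T4Continuum.NE1p.DressedSmallFieldNestedToriTower

open Set Metric MeasureTheory Complex
open scoped BigOperators
open Literature.MathematicalPhysics.QuantumFieldTheory.Balaban1983to89
open Literature.MathematicalPhysics.QuantumFieldTheory.Balaban1983to89.B12TreeDecay (K₀ K₀_pos)
open Literature.MathematicalPhysics.QuantumFieldTheory.Balaban1983to89.B13Resummation (locE)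
open Literature.MathematicalPhysics.QuantumFieldTheory.Balaban1983to89.TreeLengthTorus (TDom tsys torusTreeLen)
open Literature.MathematicalPhysics.QuantumFieldTheory.Balaban1983to89.TreeLengthTorusGeometry (TTouch)
open Summit.QuantumFields.BalabanUV.T4Continuum.B13HistMeasurable (B13HistM)
open Summit.QuantumFields.BalabanUV.T4Continuum.B13HistWitness (toyFrame)
open Summit.QuantumFields.BalabanUV.T4Continuum.NE1p.DressedSmallFieldCoresWitness (liveTable norm_liveTable_le ctr0 hroom0 Acst Acst_pos
  incr integral_incr_pos)
open Summit.QuantumFields.BalabanUV.T4Continuum.NE1p.DressedSmallFieldCoresMassWitness (cM cM_pos)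
open Summit.QuantumFields.BalabanUV.T4Continuum.NE1p.DressedSmallFieldNestedToriWitness (rN RN R₀N εN εN_pos hκ_N_eq hrate2_N_eq hκR_N
  h229_N_eq mN mN_nonneg hinner_N_eq)
open Summit.QuantumFields.BalabanUV.T4Continuum.NE1p.DressedSmallFieldNestedToriRod (CR torusTreeLen_CR)
open Summit.QuantumFields.BalabanUV.T4Continuum.NE1p.DressedSmallFieldComponentInnerMuNestedTori
  (muPart_locE_le_of_coresAt_pencil_components_nestedTori)

section Mu
variable (L M : ℕ) [NeZero L] [NeZero M] (r : ℝ) (hr : 0 ≤ r)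

/-! ## §1 THE μ-END FIRES ON THE TOWER AT `r₁ = ½` -/

open Classical in
/-- **S57 §1's `muPart_locE_le_of_coresAt_pencil_components_nestedTori` FIRES ON W75's TOWER DATUM** [decided toy]: coarse torus `tsys 4 (L·M)`,
FINE torus `tsys 4 (L·(L·M))`, `X₀ := CR L M`, W75's cores∕index∕activity BY NAME along the SOURCE pencil (`v := liveTable`, `μ₁ := 2`),
`A := 0 + 2·A₁T`, `r₁ := ½` (`hrate_T`, `hsmall_T`, `hRR_T` at `vW := vT` — W75 P1), `hadm_T`, `hAmp_T` (W75), W59.1's untouched clauses,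
`I := univ : Finset Unit`, `m := mN`; for `0 < μ₀ < 2` and `‖sμ‖ ≤ μ₀`.  Conclusion LITERAL. [folklore] -/
theorem towerMuEnd_fires (hL : 5 ≤ L) (k : ℕ) {μ₀ : ℝ} {sμ : ℂ} (h0 : 0 < μ₀) (h2 : μ₀ < 2) (hμ : ‖sμ‖ ≤ μ₀) :
    ‖locE (TTouch (d := 4) (N := L * M)) (fun Z : (tsys 4 (L * M)).Dom => Z.1) (actT L M r hr k sμ) (CR L M).1 -
        locE (TTouch (d := 4) (N := L * M)) (fun Z : (tsys 4 (L * M)).Dom => Z.1) (actT L M r hr k 0) (CR L M).1‖ ≤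
      Real.exp 1 * 9 * 64 * K₀ 64 8 ^ 2 * (0 + 2 * A₁T) * Real.exp (-(1 / 2 * torusTreeLen (CR L M).1)) * (μ₀ / (2 - μ₀)) :=
  have h3 : 3 ≤ L := by omega
  muPart_locE_le_of_coresAt_pencil_components_nestedTori h3 (GT L M r hr)
    (Win := Set.univ) (ctr := ctr0) (ROp := fun _ => 1) (RHist := fun _ => 2) (R' := fun _ => 2)
    (mq := fun _ _ _ => 1) (bq := fun _ _ _ => 0) (N₀ := fun _ _ _ => 1)
    hroom0 (fun _ _ _ _ _ _ _ => one_pos)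
    (fun _ _ _ _ _ _ _ => ⟨fun _ _ => aestronglyMeasurable_const, fun _ => differentiableOn_const _, fun _ _ _ => by
      show ‖(1 : ℂ)‖ ≤ 1; rw [norm_one]⟩)
    (fun _ _ _ _ _ _ _ => ⟨fun _ _ => (Complex.measurable_ofReal.comp (measurable_snd.norm.pow_const 2)).aestronglyMeasurable,
      fun _ _ => differentiableOn_const _, fun _ _ _ v => by
        show 1 * ‖v‖ ^ 2 - 0 ≤ (((‖v‖ ^ 2 : ℝ) : ℂ)).re; rw [Complex.ofReal_re]; simp⟩)
    (g := fun _ => 0) (Set.mem_univ _) (U := ()) (o := 0) (h₀ := 0) (v := liveTable) (μ₁ := 2)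
    (by show ‖(0 : ℂ) - 0‖ ≤ 1; simp)
    (by show ‖(0 : B13HistM toyFrame) - 0‖ + 2 * ‖liveTable‖ ≤ 2; rw [sub_zero, norm_zero, zero_add];
        linarith [norm_liveTable_le])
    (emb := fun _ => k) (fun _ => rfl) (terms := termsT L M) (act := actT L M r hr k) (fun _ _ _ => rfl)
    (A := 0 + 2 * A₁T) (r₁ := 1 / 2) (CR L M) (sμ := sμ) (by have := A₁T_pos; positivity) (by norm_num) hrate_T hsmall_T
    (fun _ => (Finset.univ : Finset Unit)) (mN L (L * M)) (mN_nonneg L (L * M))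
    (ε := εN L) (c₀ := 0) (R₀ := R₀N L) (r := rN) (R := RN) (vW := vT)
    (εN_pos L).le vT_pos.le (fun Z₀ => (hinner_N_eq L (L * M) Z₀).le) (hκR_N L h3) (hrate2_N_eq L h3).le hκ_N_eq.le
    (h229_N_eq L).le hRR_T (hadm_T L M hL) (hAmp_T L M r hr k) h0 h2 hμ

open Classical in
/-- **… IN CLOSED FORM: `≤ (K₀(64,8)∕2)·e^{−3}·μ₀∕(2 − μ₀)`** (`torusTreeLen_CR = 1`: `e·9·64·K₀²·(2·A·e^{−5∕2}∕4)·e^{−1∕2} = (K₀∕2)·e^{−3}`). [folklore] -/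
theorem towerMuEnd_fires_closed (hL : 5 ≤ L) (k : ℕ) {μ₀ : ℝ} {sμ : ℂ} (h0 : 0 < μ₀) (h2 : μ₀ < 2) (hμ : ‖sμ‖ ≤ μ₀) :
    ‖locE (TTouch (d := 4) (N := L * M)) (fun Z : (tsys 4 (L * M)).Dom => Z.1) (actT L M r hr k sμ) (CR L M).1 -
        locE (TTouch (d := 4) (N := L * M)) (fun Z : (tsys 4 (L * M)).Dom => Z.1) (actT L M r hr k 0) (CR L M).1‖ ≤
      K₀ 64 8 / 2 * Real.exp (-3) * (μ₀ / (2 - μ₀)) := by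
  refine (towerMuEnd_fires L M r hr hL k h0 h2 hμ).trans (le_of_eq ?_)
  rw [torusTreeLen_CR L M hL, mul_one]
  unfold A₁T Acst
  have hK := K₀_pos (64 : ℝ) 8
  have he := Real.exp_pos 1
  have h3 : Real.exp (-(5 / 2 : ℝ)) * Real.exp (-(1 / 2)) = Real.exp (-3) := by rw [← Real.exp_add]; norm_num
  rw [← h3]
  field_simp
  ring

/-! ## §2 LIVENESS IN THE PUNCTURED REAL WINDOW -/

open Classical in
/-- **THE μ-END's QUANTITY IS NOT ZERO** [decided toy]: for a REAL source `0 < t ≤ 2`, `E_{act t}(C_R) ≠ E_{act 0}(C_R)` — exponentials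
`1 + act t (C_R) ≠ 1 + act 0 (C_R)` (W75 P3 `exp_locE_actT`; P2 `actT_real_sub_zero`; W33 `integral_incr_pos` at the rate `t·r > 0`). [folklore] -/
theorem towerMuEnd_live (hL : 5 ≤ L) (hr0 : 0 < r) (k : ℕ) {t : ℝ} (ht0 : 0 < t) (ht2 : t ≤ 2) :
    locE (TTouch (d := 4) (N := L * M)) (fun Z : (tsys 4 (L * M)).Dom => Z.1) (actT L M r hr k (t : ℂ)) (CR L M).1 ≠
      locE (TTouch (d := 4) (N := L * M)) (fun Z : (tsys 4 (L * M)).Dom => Z.1) (actT L M r hr k 0) (CR L M).1 := by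
  intro h
  have ht : ‖(t : ℂ)‖ ≤ 2 := by rw [Complex.norm_real, Real.norm_eq_abs, abs_of_pos ht0]; exact ht2
  have h' := congrArg cexp h
  rw [exp_locE_actT L M r hr hL k ht, exp_locE_actT L M r hr hL k (by simp), add_right_inj] at h'
  have h0 := sub_eq_zero.2 h'
  rw [actT_real_sub_zero L M r hr hL] at h0
  have hc : 0 < cM r / 2 * Real.exp (-(5 / 2)) * (εN L ^ 3 + vT ^ 3) :=
    mul_pos (mul_pos (half_pos (cM_pos r)) (Real.exp_pos _)) (mass_pos L)
  rcases mul_eq_zero.1 h0 with hc0 | hI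
  · exact hc.ne' (by exact_mod_cast hc0)
  · exact (integral_incr_pos (t * r) (mul_pos ht0 hr0)).ne' (by exact_mod_cast hI)

/-! ## §3 LOCATED: where the μ-END beats W75's table END on this datum — the window algebra `μ₀∕(2−μ₀) ≤ 2 ↔ μ₀ ≤ 4∕3` -/

/-- **`μ-bound ≤ table bound ↔ μ₀ ≤ 4∕3`** [arith]: `(K₀∕2)·e^{−3}·μ₀∕(2−μ₀) ≤ K₀·e^{−3}` iff `μ₀ ≤ 4∕3`, for `0 < μ₀ < 2` — the threshold is the
source-window algebra alone (the same `4∕3` W81∕W82 located on their data). [folklore] -/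
theorem muBound_le_tableBound_iff {μ₀ : ℝ} (h0 : 0 < μ₀) (h2 : μ₀ < 2) :
    K₀ 64 8 / 2 * Real.exp (-3) * (μ₀ / (2 - μ₀)) ≤ K₀ 64 8 * Real.exp (-3) ↔ μ₀ ≤ 4 / 3 := by
  have hK := K₀_pos (64 : ℝ) 8
  have he := Real.exp_pos (-3)
  have hd : 0 < 2 - μ₀ := by linarith
  have hKe : 0 < K₀ 64 8 * Real.exp (-3) := mul_pos hK he
  have key : K₀ 64 8 / 2 * Real.exp (-3) * (μ₀ / (2 - μ₀)) = (K₀ 64 8 * Real.exp (-3)) * (μ₀ / (2 * (2 - μ₀))) := by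
    field_simp
  rw [key, mul_le_iff_le_one_right hKe, div_le_one (by positivity)]
  constructor <;> intro h <;> linarith

/-- At `μ₀ = 1` (the source value W75's table END uses) the μ-END's bound is HALF the table bound. [arith] -/
theorem muBound_at_one : K₀ 64 8 / 2 * Real.exp (-3) * (1 / (2 - 1)) = (K₀ 64 8 * Real.exp (-3)) / 2 := by ring

open Classical in
/-- **THE μ-END OFF THE BOUNDARY ON THE TOWER, LIVE, AT `L = 5` AND SOURCE `1`** [decided toy]: bound `(K₀∕2)e^{−3}·1` ∧ liveness, every `M`,
`0 < r`, `k` — next to W75's table END on the same datum (`towerEnd_fires_closed`). -/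
example (hr0 : 0 < r) (k : ℕ) :
    ‖locE (TTouch (d := 4) (N := 5 * M)) (fun Z : (tsys 4 (5 * M)).Dom => Z.1) (actT 5 M r hr k ((1 : ℝ) : ℂ)) (CR 5 M).1 -
        locE (TTouch (d := 4) (N := 5 * M)) (fun Z : (tsys 4 (5 * M)).Dom => Z.1) (actT 5 M r hr k 0) (CR 5 M).1‖ ≤
      K₀ 64 8 / 2 * Real.exp (-3) * (1 / (2 - 1)) ∧
    locE (TTouch (d := 4) (N := 5 * M)) (fun Z : (tsys 4 (5 * M)).Dom => Z.1) (actT 5 M r hr k ((1 : ℝ) : ℂ)) (CR 5 M).1 ≠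
      locE (TTouch (d := 4) (N := 5 * M)) (fun Z : (tsys 4 (5 * M)).Dom => Z.1) (actT 5 M r hr k 0) (CR 5 M).1 ∧
    ‖locE (TTouch (d := 4) (N := 5 * M)) (fun Z : (tsys 4 (5 * M)).Dom => Z.1) (actT 5 M r hr k 1) (CR 5 M).1 -
        locE (TTouch (d := 4) (N := 5 * M)) (fun Z : (tsys 4 (5 * M)).Dom => Z.1) (actT 5 M r hr k 0) (CR 5 M).1‖ ≤ K₀ 64 8 * Real.exp (-3) :=
  ⟨towerMuEnd_fires_closed 5 M r hr (by norm_num) k one_pos (by norm_num) (by rw [Complex.norm_real]; norm_num),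
    towerMuEnd_live 5 M r hr (by norm_num) hr0 k one_pos (by norm_num), towerEnd_fires_closed 5 M r hr (by norm_num) k⟩

end Mu

end Summit.QuantumFields.BalabanUV.T4Continuum.NE1p.DressedSmallFieldNestedToriTower

end
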